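import Literature.RingTheory.Etale.IdempotentScheme

/-!
# Local rings with pointed retractions of étale algebras are strictly henselian

[cite: StacksProject, Tag 04GG (7)⇒(1),(8); Tag 097V; BhattScholze2015 = arXiv:1309.1198v2,
Definition 2.2.1 and Lemma 2.2.9]

Let `C` be a ring and `m` a maximal ideal such that every étale `C`-algebra `Y` admits, for
every prime `q` over `m`, a `C`-algebra map `Y → C_m` pulling the maximal ideal back to `q`
(`HasPointedRetractions C m`; `StrictHenselOfSplitting.exists_algHom_localization_comap_eq`
produces this from the retraction property of faithfully flat étale covers, Stacks 097X).  We show that the local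
ring `C_m` behaves like a strictly henselian local ring in the two respects needed for Olivier's
theorem (Stacks 092Z) and hence for Bhatt–Scholze, Theorem 2.3.4:

* `isSepClosed_residueField` — the residue field of `C_m` is separably closed;
* `exists_idempotent_lift` — idempotents of `κ[X]/(F)` lift to `C_m[X]/(F)` for monic `F`
  (via the étale scheme of idempotents `IdemAlg`, Stacks 04GG);
* `isLocalRing_of_isIntegral` — every integral `C_m`-algebra which is a domain is local
  (Stacks 04GG (8)).
-/

universe u

namespace Literature.RingTheory.Etale

open Polynomial IsLocalRing

noncomputable section

variable {C : Type u} [CommRing C]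

/-- **Pointed retractions at `m`.**  Every étale `C`-algebra `Y` admits, for every prime `q`
of `Y` above `m`, a `C`-algebra map `r : Y → C_m` with `r⁻¹(m C_m) = q`.  When every faithfully flat
étale `C`-algebra has a retraction this holds at every maximal ideal
(`exists_algHom_localization_comap_eq` in `StrictHenselOfSplitting.lean`, Stacks 097X).
[cite: BhattScholze2015, Lemma 2.2.9; StacksProject, Tag 04GG (7)] -/
def HasPointedRetractions (C : Type u) [CommRing C] (m : Ideal C) [m.IsMaximal] : Prop :=
  ∀ (Y : Type u) [CommRing Y] [Algebra C Y] [Algebra.Etale C Y] (q : Ideal Y) [q.IsPrime],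
    q.under C = m → ∃ r : Y →ₐ[C] Localization.AtPrime m, (maximalIdeal _).comap r = q

variable {m : Ideal C} [m.IsMaximal]

section SepClosed

/-- The residue field of `C_m` is separably closed when `C` has pointed retractions at `m`:
a separable polynomial `p` over `κ(m)` lifts to a monic `F` over `C`, the standard étale
algebra `(C[X]/F)[1/F']` has a prime over `m` (it maps to `κ[X]/(p) ≠ 0`), and a retraction
to `C_m` produces a root of `p` in `κ(m)`. [cite: StacksProject, Tag 04GG (7)⇒ strictly henselian
residue field argument, Tag 094Z; BhattScholze2015, Definition 2.2.1] -/
theorem isSepClosed_residueField (h : HasPointedRetractions C m) :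
    IsSepClosed m.ResidueField := by
  classical
  refine IsSepClosed.of_exists_root _ fun p hpm hpi hps => ?_
  -- lift `p` to a monic polynomial over `C`
  have hsurj : Function.Surjective (algebraMap C m.ResidueField) :=
    Ideal.algebraMap_residueField_surjective m
  obtain ⟨F, hFp, -, hFm⟩ := Polynomial.lifts_and_degree_eq_and_monic
    ((Polynomial.mem_lifts p).2 (Polynomial.map_surjective _ hsurj p)) hpm
  -- the standard étale algebra `(C[X]/F)[1/F']`
  let P : StandardEtalePair C := ⟨F, hFm, derivative F, 1, 0, 1, by simp⟩
  -- its point in `κ[X]/(p)`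
  haveI : Nontrivial (AdjoinRoot p) := AdjoinRoot.nontrivial p (degree_pos_of_irreducible hpi).ne'
  have hroot : P.HasMap (AdjoinRoot.root p) := by
    constructor
    · change aeval (AdjoinRoot.root p) F = 0
      rw [← aeval_map_algebraMap m.ResidueField (AdjoinRoot.root p) F, hFp, AdjoinRoot.aeval_eq,
        AdjoinRoot.mk_self]
    · change IsUnit (aeval (AdjoinRoot.root p) (derivative F))
      rw [← aeval_map_algebraMap m.ResidueField (AdjoinRoot.root p), ← derivative_map, hFp]
      obtain ⟨a, b, hab⟩ := (separable_def' p).1 hps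
      have := congrArg (aeval (AdjoinRoot.root p)) hab
      simp only [map_add, map_mul, map_one, AdjoinRoot.aeval_eq, AdjoinRoot.mk_self, mul_zero,
        zero_add] at this
      rw [AdjoinRoot.aeval_eq]
      exact IsUnit.of_mul_eq_one _ (by rwa [mul_comm] at this)
  let φ : P.Ring →ₐ[C] AdjoinRoot p := P.lift _ hroot
  -- a prime of `P.Ring` above `m`
  obtain ⟨n, hn⟩ := Ideal.exists_maximal (AdjoinRoot p)
  let q : Ideal P.Ring := n.comap φ
  haveI : q.IsPrime := Ideal.comap_isPrime φ n
  have hq : q.under C = m := by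
    refine ((Ideal.IsMaximal.eq_of_le inferInstance (Ideal.IsPrime.ne_top inferInstance) ?_)).symm
    intro c hc
    rw [Ideal.under_def, Ideal.mem_comap, Ideal.mem_comap, AlgHom.commutes,
      IsScalarTower.algebraMap_apply C m.ResidueField (AdjoinRoot p)]
    have : algebraMap C m.ResidueField c = 0 := by
      rw [IsScalarTower.algebraMap_apply C (Localization.AtPrime m) m.ResidueField,
        IsLocalRing.ResidueField.algebraMap_eq, IsLocalRing.residue_eq_zero_iff]
      exact (IsLocalization.AtPrime.to_map_mem_maximal_iff (Localization.AtPrime m) m c).2 hc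
    rw [this, map_zero]; exact zero_mem n
  -- the retraction gives a root
  obtain ⟨r, -⟩ := h P.Ring q hq
  refine ⟨algebraMap _ m.ResidueField (r P.X), ?_⟩
  have h1 : aeval (r P.X) F = 0 := by rw [aeval_algHom_apply, P.hasMap_X.1, map_zero]
  rw [← hFp, eval_map, ← aeval_def,
    ← IsScalarTower.toAlgHom_apply C (Localization.AtPrime m) m.ResidueField,
    aeval_algHom_apply, h1, map_zero]

end SepClosed

section IdempotentLift

/-- C-algebra maps into `κ(m)` are determined by their kernel containing a given ideal: if
`g y = 0` whenever `y ∈ q` and `ψ` kills `q` too, then `ψ = g` — because `C → κ(m)` is onto.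
[folklore] -/
theorem algHom_residueField_ext {Y : Type u} [CommRing Y] [Algebra C Y]
    (g ψ : Y →ₐ[C] m.ResidueField) (hker : ∀ y, g y = 0 → ψ y = 0) : ψ = g := by
  ext y
  obtain ⟨c, hc⟩ := Ideal.algebraMap_residueField_surjective m (g y)
  have h1 : g (y - algebraMap C Y c) = 0 := by rw [map_sub, AlgHom.commutes, hc, sub_self]
  have h2 := hker _ h1
  rw [map_sub, AlgHom.commutes, sub_eq_zero] at h2
  rw [h2, hc]

/-- **Idempotent lifting for `C_m[X]/(F)`.**  If `C` has pointed retractions at `m`, then for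
every monic `F` over `C_m`, every idempotent of `κ(m)[X]/(F̄)` lifts to an idempotent of
`C_m[X]/(F)` (stated polynomially: `t₀` idempotent modulo `F̄` lifts to `t` idempotent modulo
`F` with `t̄ ≡ t₀ (mod F̄)`).  Proof: clear denominators to get a monic model `F₀` over an
étale localization `B = C[1/b]`; the `κ`-point of the étale scheme of idempotents `IdemAlg F₀`
given by `t₀` yields a prime over `m`, the pointed retraction a `C_m`-point, i.e. the desired
idempotent. [cite: StacksProject, Tag 04GG (7)⇒(2); BhattScholze2015, Lemma 2.2.9] -/
theorem exists_idempotent_lift (h : HasPointedRetractions C m)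
    (F : (Localization.AtPrime m)[X]) (hF : F.Monic) (t₀ : m.ResidueField[X])
    (ht₀ : F.map (residue _) ∣ t₀ * t₀ - t₀) :
    ∃ t : (Localization.AtPrime m)[X],
      F ∣ t * t - t ∧ F.map (residue _) ∣ t.map (residue _) - t₀ := by
  classical
  -- Notation
  set R := Localization.AtPrime m
  set d := F.natDegree
  -- clear denominators of the coefficients of `F`
  obtain ⟨b, hb⟩ := IsLocalization.exist_integer_multiples_of_finite m.primeCompl
    (fun i : Fin d => F.coeff i)
  choose c hc using hb
  let B := Localization.Away (b : C)
  haveI : Algebra.Etale C B := Algebra.Etale.of_isLocalizationAway (b : C)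
  have hbR : IsUnit (algebraMap C R b) :=
    (IsLocalization.AtPrime.isUnit_to_map_iff R m (b : C)).2 b.2
  letI : Algebra B R := (IsLocalization.Away.lift (b : C) hbR).toAlgebra
  haveI : IsScalarTower C B R := IsScalarTower.of_algebraMap_eq fun x =>
    (IsLocalization.Away.lift_eq (b : C) hbR x).symm
  have hbB : IsUnit (algebraMap C B b) := IsLocalization.Away.algebraMap_isUnit (b : C)
  -- the monic model
  let q₀ : Fin d → B := fun i => algebraMap C B (c i) * ↑(hbB.unit⁻¹)
  let F₀ : B[X] := X ^ d + polyOf q₀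
  have hF₀ : F₀.Monic := monic_X_pow_add (degree_polyOf_lt q₀)
  have hq₀ : ∀ i, algebraMap B R (q₀ i) = F.coeff i := by
    intro i
    have e1 : (↑(hbB.unit⁻¹) : B) * algebraMap C B b = 1 := hbB.unit.inv_mul
    have h1 : algebraMap B R ↑(hbB.unit⁻¹) * algebraMap C R b = 1 := by
      rw [IsScalarTower.algebraMap_apply C B R, ← map_mul, e1, map_one]
    have h2 : algebraMap C R (c i) = algebraMap C R b * F.coeff i := by
      rw [hc i, Algebra.smul_def]
    change algebraMap B R (algebraMap C B (c i) * ↑(hbB.unit⁻¹)) = F.coeff i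
    rw [map_mul, ← IsScalarTower.algebraMap_apply, h2]
    calc algebraMap C R ↑b * F.coeff ↑i * algebraMap B R ↑(hbB.unit⁻¹)
        = (algebraMap B R ↑(hbB.unit⁻¹) * algebraMap C R b) * F.coeff i := by ring
      _ = F.coeff i := by rw [h1, one_mul]
  have hF₀F : F₀.map (algebraMap B R) = F := by
    have : F₀.map (algebraMap B R) = X ^ d + polyOf (fun i : Fin d => F.coeff i) := by
      simp only [F₀, Polynomial.map_add, Polynomial.map_pow, map_X, polyOf_map]
      congr 2; exact funext hq₀
    have hFsum : F = X ^ d + polyOf (fun i : Fin d => F.coeff i) := by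
      conv_lhs => rw [hF.as_sum, Finset.sum_range]
      rfl
    rw [this, ← hFsum]
  -- residue field as a `B`-algebra
  letI : Algebra B m.ResidueField := ((residue R).comp (algebraMap B R)).toAlgebra
  haveI : IsScalarTower B R m.ResidueField := IsScalarTower.of_algebraMap_eq fun x => rfl
  haveI : IsScalarTower C B m.ResidueField := IsScalarTower.of_algebraMap_eq fun x => by
    rw [IsScalarTower.algebraMap_apply C R m.ResidueField, IsScalarTower.algebraMap_apply C B R]
    rfl
  have hFκ : F₀.map (algebraMap B m.ResidueField) = (F₀.map (algebraMap B R)).map (residue R) :=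
    (Polynomial.map_map _ _ F₀).symm
  -- the scheme of idempotents and its `κ`-point
  haveI : Algebra.Etale B (IdemAlg F₀) := IdemAlg.etale hF₀
  haveI : Algebra.Etale C (IdemAlg F₀) := Algebra.Etale.comp C B (IdemAlg F₀)
  have hē : IsIdempotentElem (AdjoinRoot.mk (F₀.map (algebraMap B m.ResidueField)) t₀) := by
    rw [IsIdempotentElem, ← map_mul, eq_comm, AdjoinRoot.mk_eq_mk, dvd_sub_comm, hFκ, hF₀F]
    exact ht₀
  obtain ⟨g, hg⟩ := IdemAlg.exists_eq_idem hF₀ _ hē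
  -- the prime below the point lies over `m`
  let q : Ideal (IdemAlg F₀) := RingHom.ker g.toRingHom
  haveI : q.IsPrime := RingHom.ker_isPrime _
  have hq : q.under C = m := by
    ext x
    rw [Ideal.under_def, Ideal.mem_comap, RingHom.mem_ker, AlgHom.toRingHom_eq_coe,
      AlgHom.coe_toRingHom, IsScalarTower.algebraMap_apply C B (IdemAlg F₀), AlgHom.commutes,
      ← IsScalarTower.algebraMap_apply, IsScalarTower.algebraMap_apply C R m.ResidueField,
      IsLocalRing.ResidueField.algebraMap_eq, IsLocalRing.residue_eq_zero_iff]
    exact IsLocalization.AtPrime.to_map_mem_maximal_iff R m x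
  -- the pointed retraction, as a `B`-algebra map
  obtain ⟨r, hr⟩ := h (IdemAlg F₀) q hq
  have hrB : ∀ x : B, r (algebraMap B (IdemAlg F₀) x) = algebraMap B R x := by
    intro x
    have : r.toRingHom.comp (algebraMap B (IdemAlg F₀)) = algebraMap B R := by
      refine IsLocalization.ringHom_ext (Submonoid.powers (b : C)) ?_
      ext y
      simp only [RingHom.coe_comp, Function.comp_apply, AlgHom.toRingHom_eq_coe,
        AlgHom.coe_toRingHom]
      rw [← IsScalarTower.algebraMap_apply, AlgHom.commutes, IsScalarTower.algebraMap_apply C B R]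
    exact DFunLike.congr_fun this x
  let r' : IdemAlg F₀ →ₐ[B] R := { r.toRingHom with commutes' := hrB }
  let ρ : R →ₐ[B] m.ResidueField := { residue R with commutes' := fun x => rfl }
  -- the two `κ`-points agree
  have hρr : ρ.comp r' = g := by
    have h1 : (ρ.comp r').restrictScalars C = g.restrictScalars C := by
      refine algHom_residueField_ext _ _ fun y hy => ?_
      change residue R (r y) = 0
      rw [IsLocalRing.residue_eq_zero_iff, ← Ideal.mem_comap, hr]
      exact hy
    ext y; exact DFunLike.congr_fun h1 y
  -- the lifted idempotent
  rw [← hF₀F]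
  refine ⟨polyOf (IdemAlg.coords F₀ r'), (isSol_iff_dvd hF₀ _).1 (IdemAlg.isSol_coords F₀ r'),
    ?_⟩
  rw [← hFκ, ← AdjoinRoot.mk_eq_mk]
  change AdjoinRoot.mk _ ((polyOf (IdemAlg.coords F₀ r')).map ρ.toRingHom) = _
  rw [← IdemAlg.rootMap_mk ρ, ← IdemAlg.idem, ← IdemAlg.idem_comp, hρr, hg]

end IdempotentLift

section Henselian

/-- Over a local ring `R`, in a finite `R`-algebra `D`, `1 - j` is a unit for every
`j ∈ 𝔪_R D` (Nakayama). [folklore] -/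
theorem isUnit_one_sub_of_mem_map_maximalIdeal {R : Type u} [CommRing R] [IsLocalRing R]
    {D : Type u} [CommRing D] [Algebra R D] [Module.Finite R D] (j : D)
    (hj : j ∈ (maximalIdeal R).map (algebraMap R D)) : IsUnit (1 - j) := by
  let N : Submodule R D := (Ideal.span {1 - j}).restrictScalars R
  have hle : (⊤ : Submodule R D) ≤ N ⊔ maximalIdeal R • ⊤ := by
    intro x _
    have hx : x = x * (1 - j) + x * j := by ring
    rw [hx]
    refine Submodule.add_mem_sup ?_ ?_
    · exact Ideal.mul_mem_left _ x (Ideal.subset_span rfl)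
    · rw [Ideal.smul_top_eq_map]
      exact Ideal.mul_mem_left _ x hj
  have htop : (⊤ : Submodule R D) ≤ N :=
    Submodule.le_of_le_smul_of_le_jacobson_bot Module.Finite.fg_top
      (IsLocalRing.maximalIdeal_le_jacobson ⊥) hle
  have h1 : (1 : D) ∈ Ideal.span {1 - j} := htop Submodule.mem_top
  obtain ⟨a, ha⟩ := Ideal.mem_span_singleton'.1 h1
  exact IsUnit.of_mul_eq_one a (by rw [mul_comm, ha])

/-- A polynomial whose reduction modulo `𝔪_R` vanishes takes values in `𝔪_R D`. [folklore] -/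
theorem aeval_mem_of_map_residue_eq_zero {R : Type u} [CommRing R] [IsLocalRing R]
    {D : Type u} [CommRing D] [Algebra R D] (W : R[X]) (hW : W.map (residue R) = 0) (a : D) :
    aeval a W ∈ (maximalIdeal R).map (algebraMap R D) := by
  rw [aeval_eq_sum_range]
  refine Ideal.sum_mem _ fun i _ => ?_
  rw [Algebra.smul_def]
  refine Ideal.mul_mem_right _ _ (Ideal.mem_map_of_mem _ ?_)
  rw [← IsLocalRing.residue_eq_zero_iff, ← Polynomial.coeff_map, hW, coeff_zero]

/-- In a commutative ring, `x^(N+1) y = x^N` makes `x^N y^N` an idempotent `ε` with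
`x^N ε = x^N`. [folklore] -/
theorem isIdempotentElem_of_pow_succ_mul {A : Type u} [CommRing A] (x y : A) (N : ℕ)
    (h : x ^ (N + 1) * y = x ^ N) :
    IsIdempotentElem (x ^ N * y ^ N) ∧ x ^ N * (x ^ N * y ^ N) = x ^ N := by
  have key : ∀ k, x ^ (N + k) * y ^ k = x ^ N := by
    intro k
    induction k with
    | zero => simp
    | succ k ih =>
      calc x ^ (N + (k + 1)) * y ^ (k + 1) = (x ^ (N + 1) * y) * (x ^ k * y ^ k) := by ring
        _ = x ^ N * (x ^ k * y ^ k) := by rw [h]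
        _ = x ^ (N + k) * y ^ k := by ring
        _ = x ^ N := ih
  constructor
  · calc x ^ N * y ^ N * (x ^ N * y ^ N) = (x ^ (N + N) * y ^ N) * y ^ N := by ring
      _ = x ^ N * y ^ N := by rw [key N]
  · calc x ^ N * (x ^ N * y ^ N) = x ^ (N + N) * y ^ N := by ring
      _ = x ^ N := key N

/-- **Finite domains over `C_m` are local** when `C` has pointed retractions at `m`
(Stacks 04GG (8) for domains): for `a ∈ D`, an idempotent of the Artinian ring `κ[X]/(F̄)`
(`F` a monic equation of `a`) attached to the image of `X` lifts to `C_m[X]/(F)` and maps to an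
idempotent `e ∈ D`, which is `0` or `1`; accordingly `1 - a` or `a` is a unit.
[cite: StacksProject, Tag 04GG; BhattScholze2015, Lemma 2.2.9] -/
theorem isLocalRing_of_isDomain_of_finite (h : HasPointedRetractions C m) (D : Type u)
    [CommRing D] [IsDomain D] [Algebra (Localization.AtPrime m) D]
    [Module.Finite (Localization.AtPrime m) D] : IsLocalRing D := by
  classical
  set R := Localization.AtPrime m
  refine IsLocalRing.of_isUnit_or_isUnit_one_sub_self fun a => ?_
  -- a monic equation for `a` and the Artinian `κ`-algebra `κ[X]/(F̄)`
  obtain ⟨F, hFm, hFa⟩ : IsIntegral R a := Algebra.IsIntegral.isIntegral a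
  set Fb : m.ResidueField[X] := F.map (residue R) with hFb
  haveI : Module.Finite m.ResidueField (AdjoinRoot Fb) := (hFm.map _).finite_adjoinRoot
  haveI : IsArtinianRing (AdjoinRoot Fb) := IsArtinianRing.of_finite m.ResidueField _
  set x : AdjoinRoot Fb := AdjoinRoot.root Fb
  obtain ⟨n, y, hy⟩ := IsArtinian.exists_pow_succ_smul_dvd (M := AdjoinRoot Fb) x (1 : AdjoinRoot Fb)
  simp only [smul_eq_mul, mul_one] at hy
  have hy' : x ^ (n + 1 + 1) * y = x ^ (n + 1) := by
    rw [pow_succ x (n + 1), mul_assoc, mul_comm x y, ← mul_assoc, hy, ← pow_succ]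
  obtain ⟨hid, hxid⟩ := isIdempotentElem_of_pow_succ_mul x y (n + 1) hy'
  set eti := x ^ (n + 1) * y ^ (n + 1)
  -- lift the idempotent
  obtain ⟨t₀, ht₀⟩ := AdjoinRoot.mk_surjective eti
  have ht₀' : Fb ∣ t₀ * t₀ - t₀ := by
    rw [← dvd_sub_comm, ← AdjoinRoot.mk_eq_mk, map_mul, ht₀]; exact hid.eq.symm
  obtain ⟨t, ⟨s, hs⟩, htt₀⟩ := exists_idempotent_lift h F hFm t₀ ht₀'
  -- the idempotent `e = t(a)` of the domain `D`
  set e := aeval a t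
  have hFa' : aeval a F = 0 := hFa
  have he : e * e - e = 0 := by
    have := congrArg (aeval a) hs
    rwa [map_sub, map_mul, map_mul, hFa', zero_mul] at this
  have hsurj : Function.Surjective (Polynomial.map (residue R)) :=
    Polynomial.map_surjective _ IsLocalRing.residue_surjective
  rcases mul_eq_zero.1 (show e * (e - 1) = 0 by rw [mul_sub, mul_one, he]) with he0 | he1
  · -- `e = 0`: then `a ^ (n+1) ∈ 𝔪 D`, so `1 - a` is a unit
    right
    have h1 : Fb ∣ X ^ (n + 1) * t.map (residue R) - X ^ (n + 1) := by
      have h2 : Fb ∣ X ^ (n + 1) * t₀ - X ^ (n + 1) := by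
        rw [← AdjoinRoot.mk_eq_mk, map_mul, map_pow, AdjoinRoot.mk_X, ht₀]
        exact hxid
      have : X ^ (n + 1) * t.map (residue R) - X ^ (n + 1) =
          X ^ (n + 1) * (t.map (residue R) - t₀) + (X ^ (n + 1) * t₀ - X ^ (n + 1)) := by ring
      rw [this]
      exact dvd_add (dvd_mul_of_dvd_right htt₀ _) h2
    obtain ⟨v₀, hv₀⟩ := h1
    obtain ⟨v, rfl⟩ := hsurj v₀
    set W : R[X] := X ^ (n + 1) * t - X ^ (n + 1) - F * v
    have hW : W.map (residue R) = 0 := by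
      simp only [W, Polynomial.map_sub, Polynomial.map_mul, Polynomial.map_pow, map_X]
      rw [hv₀, sub_self]
    have hWa := aeval_mem_of_map_residue_eq_zero W hW a
    have : aeval a W = -a ^ (n + 1) := by
      simp only [W, map_sub, map_mul, map_pow, aeval_X, hFa', zero_mul, sub_zero]
      change a ^ (n + 1) * e - a ^ (n + 1) = -a ^ (n + 1)
      rw [he0, mul_zero, zero_sub]
    rw [this, neg_mem_iff] at hWa
    have hu := isUnit_one_sub_of_mem_map_maximalIdeal (R := R) _ hWa
    rw [← mul_neg_geom_sum] at hu
    exact isUnit_of_mul_isUnit_left hu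
  · -- `e = 1`: then `a w(a) ≡ 1 (mod 𝔪 D)`, so `a` is a unit
    left
    rw [sub_eq_zero] at he1
    -- `eti = x · w₀`
    obtain ⟨w₀, hw₀⟩ := AdjoinRoot.mk_surjective (x ^ n * y ^ (n + 1))
    have h1 : Fb ∣ t.map (residue R) - X * w₀ := by
      have h2 : Fb ∣ t₀ - X * w₀ := by
        rw [← AdjoinRoot.mk_eq_mk, ht₀, map_mul, AdjoinRoot.mk_X, hw₀]
        change x ^ (n + 1) * y ^ (n + 1) = x * (x ^ n * y ^ (n + 1))
        ring
      have : t.map (residue R) - X * w₀ = (t.map (residue R) - t₀) + (t₀ - X * w₀) := by ring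
      rw [this]; exact dvd_add htt₀ h2
    obtain ⟨v₀, hv₀⟩ := h1
    obtain ⟨v, rfl⟩ := hsurj v₀
    obtain ⟨w, rfl⟩ := hsurj w₀
    set W : R[X] := t - X * w - F * v
    have hW : W.map (residue R) = 0 := by
      simp only [W, Polynomial.map_sub, Polynomial.map_mul, map_X]
      rw [← hv₀]; ring
    have hWa := aeval_mem_of_map_residue_eq_zero W hW a
    have : aeval a W = 1 - a * aeval a w := by
      simp only [W, map_sub, map_mul, aeval_X, hFa', zero_mul, sub_zero]
      change e - a * aeval a w = 1 - a * aeval a w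
      rw [he1]
    rw [this] at hWa
    have hu := isUnit_one_sub_of_mem_map_maximalIdeal (R := R) _ hWa
    rw [sub_sub_cancel] at hu
    exact isUnit_of_mul_isUnit_left hu

/-- **Integral domains over `C_m` are local** when `C` has pointed retractions at `m`
(Stacks 04GG (8)): reduce to the finite subalgebras `C_m[a]`. This is the form used for the
integral closure `A'` in the proof of Olivier's theorem (Stacks 092Z).
[cite: StacksProject, Tag 04GG; Tag 092Z] -/
theorem isLocalRing_of_isDomain_of_isIntegral (h : HasPointedRetractions C m) (D : Type u)
    [CommRing D] [IsDomain D] [Algebra (Localization.AtPrime m) D]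
    [Algebra.IsIntegral (Localization.AtPrime m) D] : IsLocalRing D := by
  refine IsLocalRing.of_isUnit_or_isUnit_one_sub_self fun a => ?_
  set D' := Algebra.adjoin (Localization.AtPrime m) {a}
  haveI : Module.Finite (Localization.AtPrime m) D' :=
    Algebra.finite_adjoin_simple_of_isIntegral (Algebra.IsIntegral.isIntegral a)
  haveI : IsLocalRing D' := isLocalRing_of_isDomain_of_finite h D'
  have ha : a ∈ D' := Algebra.subset_adjoin rfl
  rcases IsLocalRing.isUnit_or_isUnit_one_sub_self (⟨a, ha⟩ : D') with hu | hu
  · exact Or.inl (hu.map D'.val)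
  · exact Or.inr (by simpa using hu.map D'.val)

end Henselian

end

end Literature.RingTheory.Etale
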